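import Summits.QuantumFields.BalabanUV.Beta.D1BFx.ChartDefectTwoPinsRoad
import Summits.QuantumFields.BalabanUV.Beta.D1BFx.HessKerConjugation
import Summits.QuantumFields.BalabanUV.Beta.SymCorrectorTransport

/-!
# `BalabanUV.Beta.D1BFx.ChartDefectRepair` — road «BF-x», binder row D1, PART 24-hyb HEAD: **THE RE-PAIRING OF THE (J1) ROW**
# (an2 R-D1-g48 W-6 (3), STANDING CONDITION: «a row found individually divergent along `m` is RE-PAIRED with its partner into ONE displayed row
# before pricing»; leaf-01 g34 LOCATED NOTE N-1: the `Γ × Φ` words of the `G^{Dsh}`–`G^{Dsh}` bubble (bb) are `≍ n¹` alone).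

WHAT IT TYPES.  In the eight-row skeleton `ChartDefectHead.abs_secondMoment_chartDefect_le_of_rows` four rows carry the border word `G^{Dsh} = [Λc, Dsh]`
or a `Dsh`-insertion: (ins) `hessKer G′ V W − hessKer G₀ V W` (`ColumnGaugeTwoPins.hessKer_GcombSh_sub_hessKer_G0bm`), (dd) `−½·tadpole G₀ W^{Dsh}`,
(xb) the two cross bubbles, (bb) `½·bubble G₀ G^{Dsh} G^{Dsh}` — together `hessKer G′ V W − hessKer G₀ (V + G^{Dsh}) (W + W^{Dsh})`
(`HessKerConjugation.hessKer_add_add_sub`).  §1 (`literal_sub_displaced_eq_dressed`, abstract kernels): by the SAME column-gauge invariance read at the two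
pins (`ColumnGaugeTwoPins.hessKer_columnGauge_literalPin` at the literal's `RelInv K′ (M + D) E`, `hessKer_columnGauge_regroup_cancel` at the road's
`RelInv K M E`, both with the tadpole-null slot `Nr := 0`) that four-word group IS ONE LEG INSERTION READ AT THE DRESSED VERTICES:
`hessKer K′ V W − hessKer K (V + G^{D}) (W + W^{D}) = hessKer K′ Ṽ W̃ − hessKer K Ṽ W̃`, `Ṽ := V + [Λ, M + D]`, `W̃ := W + Wmix(Λ; V) + Wgg(Λ; M + D)` —
the border word `G^{D}` never stands alone: it sits inside `Ṽ` next to `[Λ, M]` and `V`.  §2 (`conjDefect_words`, abstract): when the second kernel is a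
CONJUGATE `K′ = P∘K∘Pᵀ` the leg insertion is the CONJUGATION DEFECT AT THE FIRST KERNEL, `hessKer K (PᵀVP) (PᵀWP) − hessKer K V W`
(`HessKerConjugation.hessKer_conj_kernel`), expanded in the vertex defects `δV := PᵀVP − V`, `δW := PᵀWP − W` (`hessKer_add_add_sub`).  §3 the level-0
instances of the tree: road `G₀ = coDressKBmAt ρ_c Lc K₀` (`RelInv G₀ bhK axEc`), literal `GcombSh Lc 0` (`RelInv … (bhK + Dsh) axEc`,
`GcombSh Lc 0 = G₀ − G₀∘Dsh∘GcombSh Lc 0`, `GcombSh Lc 0 = Ψ̂∘G₀∘Ψ̂ᵀ` with `Ψ̂ = psiKS (ctrOff (d+1) Lc) Lc` — `ChartDefectResolvent`,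
`SymCorrectorTransport.GcombSh_zero_eq_conj_psiKS_KInvStep` BY NAME).  §4 at the literal of record (d = 3, `n` odd, lockB `cB = −n¹²∕4`): the dressed
first-order family is the road's OWN bm-dressed vertex BY NAME, `Ṽ = vertexOfK G₀ n S⁰` (`ColumnGaugeCombPartner.vertexOfK_G0bm_S_zero_eq_add_comm`),
for every localised second-order family `W` — so the re-paired row «(lead)» := (ins) + (dd) + (xb) + (bb) of the HEAD reads
`hessKer (GcombSh n 0) (vertexOfK G₀ n S⁰) W̃ − hessKer G₀ (vertexOfK G₀ n S⁰) W̃`: the one-loop functional's LEG INSERTION (equivalently its `Ψ̂`-CONJUGATION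
DEFECT at the road's own pin) at the road's own dressed vertices.  The five-row regrouping of the HEAD and its pricing are NOT in this file.

HONEST DEPENDENCY (cell records, verbatim): «continuum YM on T⁴ ⇐ BetaPertH ∧ nine spine estimates (0/9 proved); BetaPertH ⇐ (D1) ∧ (D4) ∧
CAP+tail; G-an2-4 gates asym, D1 and NE2/3/4.»  HONEST FRAMING (cell contract, verbatim): «discharging `BetaPertH` makes Bałaban's UV stability
UNCONDITIONAL — a real constructive-QFT result; it is NOT the continuum limit and NOT the Clay problem.»  THIS MODULE DISCHARGES NOTHING of the wall:
[folklore] kernel algebra over landed identities BY NAME; `V`, `Λ`, `W` are ABSTRACT localised families in §1–§3 (§4 names the record's first-order family,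
`W` stays generic); it prices NO row, asserts NO n-law, changes NO landed statement (`ChartDefectHead` ∕ `…Scales` stand as typed).  No definition,
no `def … : Prop`, nothing cited, 0 sorry, default heartbeats.  0∕4 row-D1 binders; (K) NOT closed; (J1) ONE OPEN ROW — four of its eight displayed rows
RE-PAIRED into one by an identity, none priced; NOT D1, NEVER «G-an2-4 closed», NOT `BetaPertH`, NOT continuum, NOT Clay.

ABSOLUTE RULE (cell charter, verbatim): «No internally-minted statement may enter as a cited fact. Every hypothesis is either kernel-proved in this
package or a verbatim quotation of a PUBLISHED theorem with page reference. The manuscript(s) under audit are NOT citable for their own disputed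
steps — they are the thing under adjudication; programme-internal (2001/route/tribunal) claims are never citable.»

Unit `b2b-balaban-beta-d1-p2` (road owner, gen 26), 2026-08-24; over `ColumnGaugeTwoPins` (gen 24), `HessKerConjugation` (gen 22), `ColumnGaugeCombPartner` (gen 24),
`ChartDefectResolvent` (gen 22), `SymCorrectorTransport` (an2) BY NAME; no existing file touched.
-/

noncomputable section

namespace Summit.QuantumFields.BalabanUV.Beta.D1BFx.ChartDefectRepair

open Literature.MathematicalPhysics.QuantumFieldTheory
open Literature.MathematicalPhysics.QuantumFieldTheory.Balaban1983to89
open Literature.MathematicalPhysics.QuantumFieldTheory.Balaban1983to89.Beta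
open StepJetData (wilsonA)
open ExpKernelCalculus (MKer comp tr tadpole bubble hessKer)
open OneStepResolventKernel (Fib LocStencil)
open OneStepKernelFamily (colH vertexOfK KInvStep)
open AffineAveraging (Site box toSite)
open AveragingContoursRooted (ctr ctrOff ctrOff_mem_box)
open Summit.QuantumFields.BalabanUV.Beta.TameKernelCalculus
open Summit.QuantumFields.BalabanUV.Beta.ChartConjugationRelative (RelInv)
open Summit.QuantumFields.BalabanUV.Beta.RelInvNullShift (spr_add)
open Summit.QuantumFields.BalabanUV.Beta.BorderedHessian (diagK bhK spr_bhK spr_KInvStep)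
open Summit.QuantumFields.BalabanUV.Beta.DshAn1 (Dsh spr_Dsh)
open Summit.QuantumFields.BalabanUV.Beta.AxialDressingRooted (coDressKBmAt axEc spr_axEc one_le_of_neZero)
open Summit.QuantumFields.BalabanUV.Beta.AxialProjectorBlockMean (bmGaugeAt)
open Summit.QuantumFields.BalabanUV.Beta.AveragingWardRootedStencils (legSite)
open Summit.QuantumFields.BalabanUV.Beta.SymAveragingHessianCounts (symVhSAt)
open Summit.QuantumFields.BalabanUV.Beta.SymSecondOrderTablesAn1 (symTablesAn1S2)
open Summit.QuantumFields.BalabanUV.Beta.CombChartStepJets (GcombSh JsB12CombSh0)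
open Summit.QuantumFields.BalabanUV.Beta.SymCorrectorKernel (psiKS spr_psiKS)
open Summit.QuantumFields.BalabanUV.Beta.SymCorrectorTransport (GcombSh_zero_eq_conj_psiKS_KInvStep)
open Summit.QuantumFields.BalabanUV.Beta.D1BFx.ColumnGaugeInvariance (loc_comm_spr)
open Summit.QuantumFields.BalabanUV.Beta.D1BFx.ColumnGaugeTwoPins (hessKer_columnGauge_regroup_cancel hessKer_columnGauge_literalPin
  hessKer_sub_hessKer_of_insertion)
open Summit.QuantumFields.BalabanUV.Beta.D1BFx.ChartDefectResolvent (relInv_G0bm_ctr relInv_GcombSh_zero spr_G0bm_ctr spr_GcombSh_zero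
  GcombSh_zero_eq_sub_defect)
open Summit.QuantumFields.BalabanUV.Beta.D1BFx.HessKerConjugation (hessKer_conj_kernel hessKer_add_add_sub)
open Summit.QuantumFields.BalabanUV.Beta.D1BFx.RawStencilSupportRows (locStencil_JsB12CombSh0_S_zero_of_decays)
open Summit.QuantumFields.BalabanUV.Beta.D1BFx.PackedColumnEnvelope (abs_colH_KInvStep_zero_le)
open Summit.QuantumFields.BalabanUV.Beta.D1BFx.DressedVertexSplit (abs_bmGaugeAt_weight_le)
open Summit.QuantumFields.BalabanUV.Beta.D1BFx.ColumnGaugeGenerator (comp_generator_axEc_comm)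
open Summit.QuantumFields.BalabanUV.Beta.D1BFx.ColumnGaugeNativeFirstOrder (loc_diagK_weight_legSite)
open Summit.QuantumFields.BalabanUV.Beta.D1BFx.ColumnGaugeCombPartner (vertexOfK_G0bm_S_zero_eq_add_comm)
open Summit.QuantumFields.BalabanUV.Beta.D1BFx.ChartDefectWords (loc_vertexOfK_of_spr)
open Summit.QuantumFields.BalabanUV.Beta.KernelWardRelative (loc_zero)
open StepDriftWitness (tadpole_zero)
open B4ContourShift (supNorm)
open LatticeForm (quo)
open B5Hk163Strip (kappa163 kappa163_pos)
open B5Hk163Decay (MG163)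
open B4TorusKernel (periodConst)

variable {D : ℕ} {F : Type*} [Fintype F]

/-! ## §1 The four border rows are ONE leg insertion read at the dressed vertices (abstract kernels) -/

section Regroup

variable {K K' M E Dk : MKer D F} {V Λ : Fin D → (Fin D → ℤ) → MKer D F} {W : Fin D → (Fin D → ℤ) → Fin D → (Fin D → ℤ) → MKer D F}

/-- [folklore] **THE RE-PAIRING IDENTITY.**  `K` the relative inverse of the straight partner `M`, `K′` of the legged partner `M + D` (same slice `E`),
`V`, `W` localised, `Λ μ y` localised generators commuting with `E`.  Then the literal-side smooth word minus the road-side DISPLACED word —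
`hessKer K′ V W − hessKer K (V + G^{D}) (W + W^{D})`, `G^{D} μ y := [Λ μ y, D]`, `W^{D} μ y ν y′ := −[Λ ν y′, [Λ μ y, D]]`, i.e. the sum of the HEAD's rows
(ins) + (dd) + (xb) + (bb) — equals ONE leg insertion `K′` versus `K` read at the DRESSED families
`Ṽ μ y := V μ y + [Λ μ y, M + D]`, `W̃ μ y ν y′ := W μ y ν y′ + ([Λ ν y′, V μ y] + [Λ μ y, V ν y′]) + [Λ μ y, [Λ ν y′, M + D]]`:
`= hessKer K′ Ṽ W̃ − hessKer K Ṽ W̃`.  (The two column-gauge cancellations of `ColumnGaugeTwoPins` §1∕§2 at `Nr := 0`, subtracted.) -/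
theorem literal_sub_displaced_eq_dressed (hK : Spr K) (hK' : Spr K') (hM : Spr M) (hE : Spr E) (hD : Spr Dk)
    (hR : RelInv K M E) (hR' : RelInv K' (M + Dk) E)
    (hV : ∀ μ y, Loc (V μ y)) (hΛ : ∀ μ y, Loc (Λ μ y)) (hΛE : ∀ μ y, comp (Λ μ y) E = comp E (Λ μ y))
    (hW : ∀ μ y ν y', Loc (W μ y ν y')) (μ ν : Fin D) (z : Fin D → ℤ) :
    hessKer K' V W μ ν z
        - hessKer K (fun μ' y => V μ' y + (comp (Λ μ' y) Dk - comp Dk (Λ μ' y)))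
            (fun μ' y ν' y' => W μ' y ν' y'
              - (comp (Λ ν' y') (comp (Λ μ' y) Dk - comp Dk (Λ μ' y)) - comp (comp (Λ μ' y) Dk - comp Dk (Λ μ' y)) (Λ ν' y'))) μ ν z
      = hessKer K' (fun μ' y => V μ' y + (comp (Λ μ' y) (M + Dk) - comp (M + Dk) (Λ μ' y)))
            (fun μ' y ν' y' => W μ' y ν' y'
              + (((comp (Λ ν' y') (V μ' y) - comp (V μ' y) (Λ ν' y')) + (comp (Λ μ' y) (V ν' y') - comp (V ν' y') (Λ μ' y)))
                + (comp (Λ μ' y) (comp (Λ ν' y') (M + Dk) - comp (M + Dk) (Λ ν' y'))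
                    - comp (comp (Λ ν' y') (M + Dk) - comp (M + Dk) (Λ ν' y')) (Λ μ' y)))) μ ν z
        - hessKer K (fun μ' y => V μ' y + (comp (Λ μ' y) (M + Dk) - comp (M + Dk) (Λ μ' y)))
            (fun μ' y ν' y' => W μ' y ν' y'
              + (((comp (Λ ν' y') (V μ' y) - comp (V μ' y) (Λ ν' y')) + (comp (Λ μ' y) (V ν' y') - comp (V ν' y') (Λ μ' y)))
                + (comp (Λ μ' y) (comp (Λ ν' y') (M + Dk) - comp (M + Dk) (Λ ν' y'))
                    - comp (comp (Λ ν' y') (M + Dk) - comp (M + Dk) (Λ ν' y')) (Λ μ' y)))) μ ν z := by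
  have h1 := hessKer_columnGauge_literalPin hK' hM hE hD hR' hV hΛ hΛE hW (Nr' := fun _ _ _ _ => 0)
    (fun _ _ _ _ => loc_zero) (fun _ _ _ _ => tadpole_zero _) μ ν z
  have h2 := hessKer_columnGauge_regroup_cancel hK hM hE hD hR hV hΛ hΛE hW (Nr := fun _ _ _ _ => 0)
    (fun _ _ _ _ => loc_zero) (fun _ _ _ _ => tadpole_zero _) μ ν z
  simp only [add_zero] at h1 h2
  rw [h1, h2]

/-- [folklore] **… AND THAT LEG INSERTION IN WORDS**: under `K′ = K − K∘X∘K′` the right-hand side of `literal_sub_displaced_eq_dressed` is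
`−½·tr (K∘X∘K′∘W̃ μ0νz) + ½·(tr (K∘X∘K′∘Ṽ μ0 ∘ K′∘Ṽ νz) + tr (K∘Ṽ μ0 ∘ K∘X∘K′∘Ṽ νz))` — every word ONE insertion of `X` between DRESSED vertices
(`ColumnGaugeTwoPins.hessKer_sub_hessKer_of_insertion` at `(Ṽ, W̃)`; the dressed families are localised: `loc_comm_spr`). -/
theorem dressed_insertion_words (hK : Spr K) (hK' : Spr K') (hM : Spr M) (hD : Spr Dk) {X : MKer D F} (hins : K' = K - comp (comp K X) K')
    (hV : ∀ μ y, Loc (V μ y)) (hΛ : ∀ μ y, Loc (Λ μ y)) (hW : ∀ μ y ν y', Loc (W μ y ν y')) (μ ν : Fin D) (z : Fin D → ℤ) :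
    hessKer K' (fun μ' y => V μ' y + (comp (Λ μ' y) (M + Dk) - comp (M + Dk) (Λ μ' y)))
            (fun μ' y ν' y' => W μ' y ν' y'
              + (((comp (Λ ν' y') (V μ' y) - comp (V μ' y) (Λ ν' y')) + (comp (Λ μ' y) (V ν' y') - comp (V ν' y') (Λ μ' y)))
                + (comp (Λ μ' y) (comp (Λ ν' y') (M + Dk) - comp (M + Dk) (Λ ν' y'))
                    - comp (comp (Λ ν' y') (M + Dk) - comp (M + Dk) (Λ ν' y')) (Λ μ' y)))) μ ν z
        - hessKer K (fun μ' y => V μ' y + (comp (Λ μ' y) (M + Dk) - comp (M + Dk) (Λ μ' y)))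
            (fun μ' y ν' y' => W μ' y ν' y'
              + (((comp (Λ ν' y') (V μ' y) - comp (V μ' y) (Λ ν' y')) + (comp (Λ μ' y) (V ν' y') - comp (V ν' y') (Λ μ' y)))
                + (comp (Λ μ' y) (comp (Λ ν' y') (M + Dk) - comp (M + Dk) (Λ ν' y'))
                    - comp (comp (Λ ν' y') (M + Dk) - comp (M + Dk) (Λ ν' y')) (Λ μ' y)))) μ ν z
      = -((1 / 2) * tr (comp (comp (comp K X) K')
            (W μ 0 ν z
              + (((comp (Λ ν z) (V μ 0) - comp (V μ 0) (Λ ν z)) + (comp (Λ μ 0) (V ν z) - comp (V ν z) (Λ μ 0)))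
                + (comp (Λ μ 0) (comp (Λ ν z) (M + Dk) - comp (M + Dk) (Λ ν z))
                    - comp (comp (Λ ν z) (M + Dk) - comp (M + Dk) (Λ ν z)) (Λ μ 0))))))
        + (1 / 2) * (tr (comp (comp (comp (comp K X) K') (V μ 0 + (comp (Λ μ 0) (M + Dk) - comp (M + Dk) (Λ μ 0))))
                (comp K' (V ν z + (comp (Λ ν z) (M + Dk) - comp (M + Dk) (Λ ν z)))))
            + tr (comp (comp K (V μ 0 + (comp (Λ μ 0) (M + Dk) - comp (M + Dk) (Λ μ 0))))
                (comp (comp (comp K X) K') (V ν z + (comp (Λ ν z) (M + Dk) - comp (M + Dk) (Λ ν z)))))) := by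
  have hMD : Spr (M + Dk) := spr_add hM hD
  have hGM : ∀ μ' y, Loc (comp (Λ μ' y) (M + Dk) - comp (M + Dk) (Λ μ' y)) := fun μ' y => loc_comm_spr hMD (hΛ μ' y)
  have hVt : ∀ μ' y, Loc (V μ' y + (comp (Λ μ' y) (M + Dk) - comp (M + Dk) (Λ μ' y))) := fun μ' y => (hV μ' y).add (hGM μ' y)
  have hWt : ∀ μ' y ν' y', Loc (W μ' y ν' y'
      + (((comp (Λ ν' y') (V μ' y) - comp (V μ' y) (Λ ν' y')) + (comp (Λ μ' y) (V ν' y') - comp (V ν' y') (Λ μ' y)))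
        + (comp (Λ μ' y) (comp (Λ ν' y') (M + Dk) - comp (M + Dk) (Λ ν' y'))
            - comp (comp (Λ ν' y') (M + Dk) - comp (M + Dk) (Λ ν' y')) (Λ μ' y)))) := fun μ' y ν' y' =>
    (hW μ' y ν' y').add
      (((((hΛ ν' y').comp (hV μ' y)).sub ((hV μ' y).comp (hΛ ν' y'))).add
          (((hΛ μ' y).comp (hV ν' y')).sub ((hV ν' y').comp (hΛ μ' y)))).add
        (((hΛ μ' y).comp (hGM ν' y')).sub ((hGM ν' y').comp (hΛ μ' y))))
  exact hessKer_sub_hessKer_of_insertion hK hK' hins hVt hWt μ ν z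

end Regroup

/-! ## §2 When the second kernel is a conjugate: the leg insertion is the CONJUGATION DEFECT at the first kernel -/

section ConjDefect

variable {K P : MKer D F} {V : Fin D → (Fin D → ℤ) → MKer D F} {W : Fin D → (Fin D → ℤ) → Fin D → (Fin D → ℤ) → MKer D F}

/-- [folklore] **THE CONJUGATION DEFECT IN WORDS.**  `K`, `P` spread, `V`, `W` localised: the one-loop functional at the conjugate kernel `P∘K∘Pᵀ` minus
at `K` is the functional at `K` of the CONJUGATED vertices minus of the plain ones (`HessKerConjugation.hessKer_conj_kernel`), hence — with the vertex
defects `δV μ y := Pᵀ∘V μ y∘P − V μ y`, `δW μ y ν y′ := Pᵀ∘W μ y ν y′∘P − W μ y ν y′` — the three-word list of `hessKer_add_add_sub`: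
`hessKer (P∘K∘Pᵀ) V W μ ν z − hessKer K V W μ ν z = ½·tadpole K (δW μ0νz) − ½·(bubble K (V μ0) (δV νz) + bubble K (δV μ0) (V νz)) − ½·bubble K (δV μ0) (δV νz)`. -/
theorem conjDefect_words (hK : Spr K) (hP : Spr P) (hV : ∀ μ y, Loc (V μ y)) (hW : ∀ μ y ν y', Loc (W μ y ν y'))
    (μ ν : Fin D) (z : Fin D → ℤ) :
    hessKer (comp (comp P K) (trK P)) V W μ ν z - hessKer K V W μ ν z
      = (1 / 2) * tadpole K (comp (comp (trK P) (W μ 0 ν z)) P - W μ 0 ν z)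
        - (1 / 2) * (bubble K (V μ 0) (comp (comp (trK P) (V ν z)) P - V ν z) + bubble K (comp (comp (trK P) (V μ 0)) P - V μ 0) (V ν z))
        - (1 / 2) * bubble K (comp (comp (trK P) (V μ 0)) P - V μ 0) (comp (comp (trK P) (V ν z)) P - V ν z) := by
  have hVc : ∀ μ' y, Loc (comp (comp (trK P) (V μ' y)) P) := fun μ' y => (hP.trK.comp_loc (hV μ' y)).comp_spr hP
  have hWc : ∀ μ' y ν' y', Loc (comp (comp (trK P) (W μ' y ν' y')) P) := fun μ' y ν' y' => (hP.trK.comp_loc (hW μ' y ν' y')).comp_spr hP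
  have hδV : ∀ μ' y, Loc (comp (comp (trK P) (V μ' y)) P - V μ' y) := fun μ' y => (hVc μ' y).sub (hV μ' y)
  have hδW : ∀ μ' y ν' y', Loc (comp (comp (trK P) (W μ' y ν' y')) P - W μ' y ν' y') := fun μ' y ν' y' => (hWc μ' y ν' y').sub (hW μ' y ν' y')
  -- conjugate vertices = plain + defect (pointwise)
  have eV : (fun μ' y => comp (comp (trK P) (V μ' y)) P) = V + fun μ' y => comp (comp (trK P) (V μ' y)) P - V μ' y := by
    funext μ' y; simp only [Pi.add_apply, add_sub_cancel]
  have eW : (fun μ' y ν' y' => comp (comp (trK P) (W μ' y ν' y')) P)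
      = W + fun μ' y ν' y' => comp (comp (trK P) (W μ' y ν' y')) P - W μ' y ν' y' := by
    funext μ' y ν' y'; simp only [Pi.add_apply, add_sub_cancel]
  rw [hessKer_conj_kernel hP hK hV hW μ ν z, eV, eW]
  exact hessKer_add_add_sub hK hV hδV hW hδW μ ν z

end ConjDefect

/-! ## §3 The level-0 kernels of the tree: road `G₀ = coDressKBmAt ρ_c Lc K₀`, literal `GcombSh Lc 0 = Ψ̂∘G₀∘Ψ̂ᵀ = G₀ − G₀∘Dsh∘GcombSh Lc 0` -/

section LevelZero

variable {d : ℕ} {Lc : ℕ} [NeZero Lc]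
  {V Λ : Fin (d + 1) → (Fin (d + 1) → ℤ) → MKer (d + 1) (Fib d)} {W : Fin (d + 1) → (Fin (d + 1) → ℤ) → Fin (d + 1) → (Fin (d + 1) → ℤ) → MKer (d + 1) (Fib d)}
  (hV : ∀ μ y, Loc (V μ y)) (hΛ : ∀ μ y, Loc (Λ μ y)) (hΛE : ∀ μ y, comp (Λ μ y) (axEc (ctr (d + 1) Lc) Lc) = comp (axEc (ctr (d + 1) Lc) Lc) (Λ μ y))
  (hW : ∀ μ y ν y', Loc (W μ y ν y'))
include hV hΛ hΛE hW

/-- [folklore] **THE RE-PAIRING AT LEVEL 0**: at `K := G₀ = coDressKBmAt (ctr (d+1) Lc) Lc (KInvStep Lc 0)` (`RelInv G₀ (bhK Lc) axEc`,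
`ChartDefectResolvent.relInv_G0bm_ctr`) and `K′ := GcombSh Lc 0` (`RelInv … (bhK Lc + Dsh Lc) axEc`, `relInv_GcombSh_zero`), for any localised `V`, `W` and
localised generators `Λ` commuting with `axEc`: (ins) + (dd) + (xb) + (bb) = `hessKer (GcombSh Lc 0) Ṽ W̃ − hessKer G₀ Ṽ W̃` with
`Ṽ = V + [Λ, bhK Lc + Dsh Lc]`, `W̃ = W + Wmix(Λ; V) + Wgg(Λ; bhK Lc + Dsh Lc)`. -/
theorem literal_sub_displaced_eq_dressed_level0 (μ ν : Fin (d + 1)) (z : Fin (d + 1) → ℤ) :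
    hessKer (GcombSh (d := d) Lc 0) V W μ ν z
        - hessKer (coDressKBmAt (ctr (d + 1) Lc) Lc (KInvStep (d := d) Lc 0))
            (fun μ' y => V μ' y + (comp (Λ μ' y) (Dsh Lc) - comp (Dsh Lc) (Λ μ' y)))
            (fun μ' y ν' y' => W μ' y ν' y'
              - (comp (Λ ν' y') (comp (Λ μ' y) (Dsh Lc) - comp (Dsh Lc) (Λ μ' y)) - comp (comp (Λ μ' y) (Dsh Lc) - comp (Dsh Lc) (Λ μ' y)) (Λ ν' y'))) μ ν z
      = hessKer (GcombSh (d := d) Lc 0) (fun μ' y => V μ' y + (comp (Λ μ' y) (bhK Lc + Dsh Lc) - comp (bhK Lc + Dsh Lc) (Λ μ' y)))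
            (fun μ' y ν' y' => W μ' y ν' y'
              + (((comp (Λ ν' y') (V μ' y) - comp (V μ' y) (Λ ν' y')) + (comp (Λ μ' y) (V ν' y') - comp (V ν' y') (Λ μ' y)))
                + (comp (Λ μ' y) (comp (Λ ν' y') (bhK Lc + Dsh Lc) - comp (bhK Lc + Dsh Lc) (Λ ν' y'))
                    - comp (comp (Λ ν' y') (bhK Lc + Dsh Lc) - comp (bhK Lc + Dsh Lc) (Λ ν' y')) (Λ μ' y)))) μ ν z
        - hessKer (coDressKBmAt (ctr (d + 1) Lc) Lc (KInvStep (d := d) Lc 0))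
            (fun μ' y => V μ' y + (comp (Λ μ' y) (bhK Lc + Dsh Lc) - comp (bhK Lc + Dsh Lc) (Λ μ' y)))
            (fun μ' y ν' y' => W μ' y ν' y'
              + (((comp (Λ ν' y') (V μ' y) - comp (V μ' y) (Λ ν' y')) + (comp (Λ μ' y) (V ν' y') - comp (V ν' y') (Λ μ' y)))
                + (comp (Λ μ' y) (comp (Λ ν' y') (bhK Lc + Dsh Lc) - comp (bhK Lc + Dsh Lc) (Λ ν' y'))
                    - comp (comp (Λ ν' y') (bhK Lc + Dsh Lc) - comp (bhK Lc + Dsh Lc) (Λ ν' y')) (Λ μ' y)))) μ ν z := by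
  have hL : 1 ≤ Lc := one_le_of_neZero Lc
  have hR' : RelInv (GcombSh (d := d) Lc 0) (bhK Lc + Dsh Lc) (axEc (ctr (d + 1) Lc) Lc) := by
    have h := relInv_GcombSh_zero (d := d) (Lc := Lc)
    rwa [one_smul] at h
  exact literal_sub_displaced_eq_dressed spr_G0bm_ctr spr_GcombSh_zero (spr_bhK hL) (spr_axEc _ _) (spr_Dsh hL)
    relInv_G0bm_ctr hR' hV hΛ hΛE hW μ ν z

omit hΛE in
/-- [folklore] **… IN INSERTION WORDS AT LEVEL 0** (`ChartDefectResolvent.GcombSh_zero_eq_sub_defect`: `X := Dsh Lc`). -/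
theorem dressed_insertion_words_level0 (μ ν : Fin (d + 1)) (z : Fin (d + 1) → ℤ) :
    hessKer (GcombSh (d := d) Lc 0) (fun μ' y => V μ' y + (comp (Λ μ' y) (bhK Lc + Dsh Lc) - comp (bhK Lc + Dsh Lc) (Λ μ' y)))
            (fun μ' y ν' y' => W μ' y ν' y'
              + (((comp (Λ ν' y') (V μ' y) - comp (V μ' y) (Λ ν' y')) + (comp (Λ μ' y) (V ν' y') - comp (V ν' y') (Λ μ' y)))
                + (comp (Λ μ' y) (comp (Λ ν' y') (bhK Lc + Dsh Lc) - comp (bhK Lc + Dsh Lc) (Λ ν' y'))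
                    - comp (comp (Λ ν' y') (bhK Lc + Dsh Lc) - comp (bhK Lc + Dsh Lc) (Λ ν' y')) (Λ μ' y)))) μ ν z
        - hessKer (coDressKBmAt (ctr (d + 1) Lc) Lc (KInvStep (d := d) Lc 0))
            (fun μ' y => V μ' y + (comp (Λ μ' y) (bhK Lc + Dsh Lc) - comp (bhK Lc + Dsh Lc) (Λ μ' y)))
            (fun μ' y ν' y' => W μ' y ν' y'
              + (((comp (Λ ν' y') (V μ' y) - comp (V μ' y) (Λ ν' y')) + (comp (Λ μ' y) (V ν' y') - comp (V ν' y') (Λ μ' y)))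
                + (comp (Λ μ' y) (comp (Λ ν' y') (bhK Lc + Dsh Lc) - comp (bhK Lc + Dsh Lc) (Λ ν' y'))
                    - comp (comp (Λ ν' y') (bhK Lc + Dsh Lc) - comp (bhK Lc + Dsh Lc) (Λ ν' y')) (Λ μ' y)))) μ ν z
      = -((1 / 2) * tr (comp (comp (comp (coDressKBmAt (ctr (d + 1) Lc) Lc (KInvStep (d := d) Lc 0)) (Dsh Lc)) (GcombSh (d := d) Lc 0))
            (W μ 0 ν z
              + (((comp (Λ ν z) (V μ 0) - comp (V μ 0) (Λ ν z)) + (comp (Λ μ 0) (V ν z) - comp (V ν z) (Λ μ 0)))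
                + (comp (Λ μ 0) (comp (Λ ν z) (bhK Lc + Dsh Lc) - comp (bhK Lc + Dsh Lc) (Λ ν z))
                    - comp (comp (Λ ν z) (bhK Lc + Dsh Lc) - comp (bhK Lc + Dsh Lc) (Λ ν z)) (Λ μ 0))))))
        + (1 / 2) * (tr (comp (comp (comp (comp (coDressKBmAt (ctr (d + 1) Lc) Lc (KInvStep (d := d) Lc 0)) (Dsh Lc)) (GcombSh (d := d) Lc 0))
                  (V μ 0 + (comp (Λ μ 0) (bhK Lc + Dsh Lc) - comp (bhK Lc + Dsh Lc) (Λ μ 0))))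
                (comp (GcombSh (d := d) Lc 0) (V ν z + (comp (Λ ν z) (bhK Lc + Dsh Lc) - comp (bhK Lc + Dsh Lc) (Λ ν z)))))
            + tr (comp (comp (coDressKBmAt (ctr (d + 1) Lc) Lc (KInvStep (d := d) Lc 0)) (V μ 0 + (comp (Λ μ 0) (bhK Lc + Dsh Lc) - comp (bhK Lc + Dsh Lc) (Λ μ 0))))
                (comp (comp (comp (coDressKBmAt (ctr (d + 1) Lc) Lc (KInvStep (d := d) Lc 0)) (Dsh Lc)) (GcombSh (d := d) Lc 0))
                  (V ν z + (comp (Λ ν z) (bhK Lc + Dsh Lc) - comp (bhK Lc + Dsh Lc) (Λ ν z)))))) := by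
  have hL : 1 ≤ Lc := one_le_of_neZero Lc
  exact dressed_insertion_words spr_G0bm_ctr spr_GcombSh_zero (spr_bhK hL) (spr_Dsh hL) GcombSh_zero_eq_sub_defect hV hΛ hW μ ν z

omit hΛ hΛE in
/-- [folklore] **THE LEG INSERTION AT LEVEL 0 IS THE `Ψ̂`-CONJUGATION DEFECT AT THE ROAD's OWN PIN**: `GcombSh Lc 0 = Ψ̂∘G₀∘Ψ̂ᵀ`,
`Ψ̂ := psiKS (ctrOff (d+1) Lc) Lc` (`SymCorrectorTransport.GcombSh_zero_eq_conj_psiKS_KInvStep`), so for ANY localised families `V`, `W`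
`hessKer (GcombSh Lc 0) V W − hessKer G₀ V W = ½·tadpole G₀ (δW μ0νz) − ½·(bubble G₀ (V μ0) (δV νz) + bubble G₀ (δV μ0) (V νz)) − ½·bubble G₀ (δV μ0) (δV νz)`,
`δV := Ψ̂ᵀ∘V∘Ψ̂ − V`, `δW := Ψ̂ᵀ∘W∘Ψ̂ − W` (§2). -/
theorem literal_sub_road_eq_conjDefect_words_level0 (μ ν : Fin (d + 1)) (z : Fin (d + 1) → ℤ) :
    hessKer (GcombSh (d := d) Lc 0) V W μ ν z - hessKer (coDressKBmAt (ctr (d + 1) Lc) Lc (KInvStep (d := d) Lc 0)) V W μ ν z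
      = (1 / 2) * tadpole (coDressKBmAt (ctr (d + 1) Lc) Lc (KInvStep (d := d) Lc 0))
            (comp (comp (trK (psiKS (ctrOff (d + 1) Lc) Lc)) (W μ 0 ν z)) (psiKS (ctrOff (d + 1) Lc) Lc) - W μ 0 ν z)
        - (1 / 2) * (bubble (coDressKBmAt (ctr (d + 1) Lc) Lc (KInvStep (d := d) Lc 0)) (V μ 0)
                (comp (comp (trK (psiKS (ctrOff (d + 1) Lc) Lc)) (V ν z)) (psiKS (ctrOff (d + 1) Lc) Lc) - V ν z)
            + bubble (coDressKBmAt (ctr (d + 1) Lc) Lc (KInvStep (d := d) Lc 0))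
                (comp (comp (trK (psiKS (ctrOff (d + 1) Lc) Lc)) (V μ 0)) (psiKS (ctrOff (d + 1) Lc) Lc) - V μ 0) (V ν z))
        - (1 / 2) * bubble (coDressKBmAt (ctr (d + 1) Lc) Lc (KInvStep (d := d) Lc 0))
            (comp (comp (trK (psiKS (ctrOff (d + 1) Lc) Lc)) (V μ 0)) (psiKS (ctrOff (d + 1) Lc) Lc) - V μ 0)
            (comp (comp (trK (psiKS (ctrOff (d + 1) Lc) Lc)) (V ν z)) (psiKS (ctrOff (d + 1) Lc) Lc) - V ν z) := by
  have hL : 1 ≤ Lc := one_le_of_neZero Lc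
  have hP : Spr (psiKS (ctrOff (d + 1) Lc) Lc) := spr_psiKS (Nat.pos_of_ne_zero (NeZero.ne Lc)) (ctrOff_mem_box hL)
  rw [GcombSh_zero_eq_conj_psiKS_KInvStep Lc]
  exact conjDefect_words spr_G0bm_ctr hP hV hW μ ν z

end LevelZero

/-! ## §4 At the literal of record: the dressed first-order family is the road's OWN bm-dressed vertex BY NAME -/

section Record

variable {n : ℕ} [NeZero n] {N : ℕ}

/-- **THE RE-PAIRED ROW «(lead)» AT THE RECORD** [our object ∕ folklore] (d = 3, `n` odd, lockB `cB = −n¹²∕4`; `G₀ := coDressKBmAt (ctr 4 n) n K₀`,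
`K₀ := KInvStep n 0`, `G′ := GcombSh n 0`, `S⁰ := (JsB12CombSh0 hodd N (symTablesAn1S2 3 n cΛ) cΛ (−n¹²∕4) 0).S`, `V^s := vertexOfK K₀ n S⁰`,
`Λc μ y := diagK (z b ↦ (n⁴∕2)·bmGaugeAt ρ_c (colH K₀ n μ y) n (legSite ρ_c z b))`, `G^{Dsh} := [Λc, Dsh n]`, `W^{Dsh} μ y ν y′ := −[Λc ν y′, [Λc μ y, Dsh n]]`).
For EVERY localised second-order family `W` and any family `Wt` DISPLAYED equal (`hWt`) to the dressed one
`W̃ := W + Wmix(Λc; V^s) + Wgg(Λc; bhK n + Dsh n)` (pinned, the HEAD's habit — no lambda family in the conclusion):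
`hessKer G′ V^s W − hessKer G₀ (V^s + G^{Dsh}) (W + W^{Dsh}) = hessKer G′ (vertexOfK G₀ n S⁰) Wt − hessKer G₀ (vertexOfK G₀ n S⁰) Wt` — the first-order family on the right is the ROAD's OWN bm-DRESSED VERTEX
(`ColumnGaugeCombPartner.vertexOfK_G0bm_S_zero_eq_add_comm`).  With `W :=` the HEAD's `W_L` (the literal's displaced second-order family at `K₀`) the
left side is the sum of the pins (ins) + (dd) + (xb) + (bb) of `ChartDefectHead` (up to `hessKer_GcombSh_sub_hessKer_G0bm` ∕ `hessKer_add_add_sub`). -/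
theorem lead_record_eq_dressed (hodd : Odd n) (cΛ : ℝ)
    {W : Fin (3 + 1) → Site (3 + 1) → Fin (3 + 1) → Site (3 + 1) → MKer (3 + 1) (Fib 3)} (hW : ∀ μ y ν y', Loc (W μ y ν y'))
    -- the dressed second-order family, PINNED by a displayed equation (the HEAD's habit; any name)
    (Wt : Fin (3 + 1) → Site (3 + 1) → Fin (3 + 1) → Site (3 + 1) → MKer (3 + 1) (Fib 3))
    (hWt : ∀ (μ' : Fin (3 + 1)) (y : Site (3 + 1)) (ν' : Fin (3 + 1)) (y' : Site (3 + 1)), Wt μ' y ν' y'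
      = W μ' y ν' y'
              + (((comp (diagK fun z' b => (n : ℝ) ^ 4 / 2 * bmGaugeAt (ctr 4 n) (colH (KInvStep (d := 3) n 0) n ν' y') n (legSite (ctr 4 n) z' b))
                      (vertexOfK (KInvStep (d := 3) n 0) n (JsB12CombSh0 hodd N (symTablesAn1S2 3 n cΛ) cΛ (-((n : ℝ) ^ 12 / 4)) 0).S μ' y)
                    - comp (vertexOfK (KInvStep (d := 3) n 0) n (JsB12CombSh0 hodd N (symTablesAn1S2 3 n cΛ) cΛ (-((n : ℝ) ^ 12 / 4)) 0).S μ' y)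
                      (diagK fun z' b => (n : ℝ) ^ 4 / 2 * bmGaugeAt (ctr 4 n) (colH (KInvStep (d := 3) n 0) n ν' y') n (legSite (ctr 4 n) z' b)))
                  + (comp (diagK fun z' b => (n : ℝ) ^ 4 / 2 * bmGaugeAt (ctr 4 n) (colH (KInvStep (d := 3) n 0) n μ' y) n (legSite (ctr 4 n) z' b))
                      (vertexOfK (KInvStep (d := 3) n 0) n (JsB12CombSh0 hodd N (symTablesAn1S2 3 n cΛ) cΛ (-((n : ℝ) ^ 12 / 4)) 0).S ν' y')
                    - comp (vertexOfK (KInvStep (d := 3) n 0) n (JsB12CombSh0 hodd N (symTablesAn1S2 3 n cΛ) cΛ (-((n : ℝ) ^ 12 / 4)) 0).S ν' y')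
                      (diagK fun z' b => (n : ℝ) ^ 4 / 2 * bmGaugeAt (ctr 4 n) (colH (KInvStep (d := 3) n 0) n μ' y) n (legSite (ctr 4 n) z' b))))
                + (comp (diagK fun z' b => (n : ℝ) ^ 4 / 2 * bmGaugeAt (ctr 4 n) (colH (KInvStep (d := 3) n 0) n μ' y) n (legSite (ctr 4 n) z' b))
                      (comp (diagK fun z' b => (n : ℝ) ^ 4 / 2 * bmGaugeAt (ctr 4 n) (colH (KInvStep (d := 3) n 0) n ν' y') n (legSite (ctr 4 n) z' b)) (bhK n + Dsh n)
                        - comp (bhK n + Dsh n) (diagK fun z' b => (n : ℝ) ^ 4 / 2 * bmGaugeAt (ctr 4 n) (colH (KInvStep (d := 3) n 0) n ν' y') n (legSite (ctr 4 n) z' b)))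
                    - comp (comp (diagK fun z' b => (n : ℝ) ^ 4 / 2 * bmGaugeAt (ctr 4 n) (colH (KInvStep (d := 3) n 0) n ν' y') n (legSite (ctr 4 n) z' b)) (bhK n + Dsh n)
                        - comp (bhK n + Dsh n) (diagK fun z' b => (n : ℝ) ^ 4 / 2 * bmGaugeAt (ctr 4 n) (colH (KInvStep (d := 3) n 0) n ν' y') n (legSite (ctr 4 n) z' b)))
                      (diagK fun z' b => (n : ℝ) ^ 4 / 2 * bmGaugeAt (ctr 4 n) (colH (KInvStep (d := 3) n 0) n μ' y) n (legSite (ctr 4 n) z' b)))))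
    (μ ν : Fin 4) (z : Site 4) :
    hessKer (GcombSh (d := 3) n 0) (vertexOfK (KInvStep (d := 3) n 0) n (JsB12CombSh0 hodd N (symTablesAn1S2 3 n cΛ) cΛ (-((n : ℝ) ^ 12 / 4)) 0).S) W μ ν z
        - hessKer (coDressKBmAt (ctr 4 n) n (KInvStep (d := 3) n 0))
            (fun μ' y => vertexOfK (KInvStep (d := 3) n 0) n (JsB12CombSh0 hodd N (symTablesAn1S2 3 n cΛ) cΛ (-((n : ℝ) ^ 12 / 4)) 0).S μ' y
              + (comp (diagK fun z' b => (n : ℝ) ^ 4 / 2 * bmGaugeAt (ctr 4 n) (colH (KInvStep (d := 3) n 0) n μ' y) n (legSite (ctr 4 n) z' b)) (Dsh n)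
                  - comp (Dsh n) (diagK fun z' b => (n : ℝ) ^ 4 / 2 * bmGaugeAt (ctr 4 n) (colH (KInvStep (d := 3) n 0) n μ' y) n (legSite (ctr 4 n) z' b))))
            (fun μ' y ν' y' => W μ' y ν' y'
              - (comp (diagK fun z' b => (n : ℝ) ^ 4 / 2 * bmGaugeAt (ctr 4 n) (colH (KInvStep (d := 3) n 0) n ν' y') n (legSite (ctr 4 n) z' b))
                    (comp (diagK fun z' b => (n : ℝ) ^ 4 / 2 * bmGaugeAt (ctr 4 n) (colH (KInvStep (d := 3) n 0) n μ' y) n (legSite (ctr 4 n) z' b)) (Dsh n)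
                      - comp (Dsh n) (diagK fun z' b => (n : ℝ) ^ 4 / 2 * bmGaugeAt (ctr 4 n) (colH (KInvStep (d := 3) n 0) n μ' y) n (legSite (ctr 4 n) z' b)))
                  - comp (comp (diagK fun z' b => (n : ℝ) ^ 4 / 2 * bmGaugeAt (ctr 4 n) (colH (KInvStep (d := 3) n 0) n μ' y) n (legSite (ctr 4 n) z' b)) (Dsh n)
                      - comp (Dsh n) (diagK fun z' b => (n : ℝ) ^ 4 / 2 * bmGaugeAt (ctr 4 n) (colH (KInvStep (d := 3) n 0) n μ' y) n (legSite (ctr 4 n) z' b)))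
                    (diagK fun z' b => (n : ℝ) ^ 4 / 2 * bmGaugeAt (ctr 4 n) (colH (KInvStep (d := 3) n 0) n ν' y') n (legSite (ctr 4 n) z' b)))) μ ν z
      = hessKer (GcombSh (d := 3) n 0) (vertexOfK (coDressKBmAt (ctr 4 n) n (KInvStep (d := 3) n 0)) n (JsB12CombSh0 hodd N (symTablesAn1S2 3 n cΛ) cΛ (-((n : ℝ) ^ 12 / 4)) 0).S) Wt μ ν z
        - hessKer (coDressKBmAt (ctr 4 n) n (KInvStep (d := 3) n 0)) (vertexOfK (coDressKBmAt (ctr 4 n) n (KInvStep (d := 3) n 0)) n (JsB12CombSh0 hodd N (symTablesAn1S2 3 n cΛ) cΛ (-((n : ℝ) ^ 12 / 4)) 0).S) Wt μ ν z := by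
  have e : (fun μ' y ν' y' => W μ' y ν' y'
              + (((comp (diagK fun z' b => (n : ℝ) ^ 4 / 2 * bmGaugeAt (ctr 4 n) (colH (KInvStep (d := 3) n 0) n ν' y') n (legSite (ctr 4 n) z' b))
                      (vertexOfK (KInvStep (d := 3) n 0) n (JsB12CombSh0 hodd N (symTablesAn1S2 3 n cΛ) cΛ (-((n : ℝ) ^ 12 / 4)) 0).S μ' y)
                    - comp (vertexOfK (KInvStep (d := 3) n 0) n (JsB12CombSh0 hodd N (symTablesAn1S2 3 n cΛ) cΛ (-((n : ℝ) ^ 12 / 4)) 0).S μ' y)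
                      (diagK fun z' b => (n : ℝ) ^ 4 / 2 * bmGaugeAt (ctr 4 n) (colH (KInvStep (d := 3) n 0) n ν' y') n (legSite (ctr 4 n) z' b)))
                  + (comp (diagK fun z' b => (n : ℝ) ^ 4 / 2 * bmGaugeAt (ctr 4 n) (colH (KInvStep (d := 3) n 0) n μ' y) n (legSite (ctr 4 n) z' b))
                      (vertexOfK (KInvStep (d := 3) n 0) n (JsB12CombSh0 hodd N (symTablesAn1S2 3 n cΛ) cΛ (-((n : ℝ) ^ 12 / 4)) 0).S ν' y')
                    - comp (vertexOfK (KInvStep (d := 3) n 0) n (JsB12CombSh0 hodd N (symTablesAn1S2 3 n cΛ) cΛ (-((n : ℝ) ^ 12 / 4)) 0).S ν' y')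
                      (diagK fun z' b => (n : ℝ) ^ 4 / 2 * bmGaugeAt (ctr 4 n) (colH (KInvStep (d := 3) n 0) n μ' y) n (legSite (ctr 4 n) z' b))))
                + (comp (diagK fun z' b => (n : ℝ) ^ 4 / 2 * bmGaugeAt (ctr 4 n) (colH (KInvStep (d := 3) n 0) n μ' y) n (legSite (ctr 4 n) z' b))
                      (comp (diagK fun z' b => (n : ℝ) ^ 4 / 2 * bmGaugeAt (ctr 4 n) (colH (KInvStep (d := 3) n 0) n ν' y') n (legSite (ctr 4 n) z' b)) (bhK n + Dsh n)
                        - comp (bhK n + Dsh n) (diagK fun z' b => (n : ℝ) ^ 4 / 2 * bmGaugeAt (ctr 4 n) (colH (KInvStep (d := 3) n 0) n ν' y') n (legSite (ctr 4 n) z' b)))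
                    - comp (comp (diagK fun z' b => (n : ℝ) ^ 4 / 2 * bmGaugeAt (ctr 4 n) (colH (KInvStep (d := 3) n 0) n ν' y') n (legSite (ctr 4 n) z' b)) (bhK n + Dsh n)
                        - comp (bhK n + Dsh n) (diagK fun z' b => (n : ℝ) ^ 4 / 2 * bmGaugeAt (ctr 4 n) (colH (KInvStep (d := 3) n 0) n ν' y') n (legSite (ctr 4 n) z' b)))
                      (diagK fun z' b => (n : ℝ) ^ 4 / 2 * bmGaugeAt (ctr 4 n) (colH (KInvStep (d := 3) n 0) n μ' y) n (legSite (ctr 4 n) z' b))))) = Wt :=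
    funext fun μ' => funext fun y => funext fun ν' => funext fun y' => (hWt μ' y ν' y').symm
  rw [← e]
  -- abbreviations
  set K₀ : MKer (3 + 1) (Fib 3) := KInvStep (d := 3) n 0 with hK₀def
  set S0 := (JsB12CombSh0 hodd N (symTablesAn1S2 3 n cΛ) cΛ (-((n : ℝ) ^ 12 / 4)) 0).S with hS0def
  set Λc : Fin (3 + 1) → Site (3 + 1) → MKer (3 + 1) (Fib 3) :=
    fun μ' y => diagK fun z' b => (n : ℝ) ^ 4 / 2 * bmGaugeAt (ctr 4 n) (colH K₀ n μ' y) n (legSite (ctr 4 n) z' b) with hΛcdef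
  have hn1 : 1 ≤ n := Nat.one_le_iff_ne_zero.2 (NeZero.ne n)
  -- the straight kernel is spread, the record's first-order table a local stencil family
  have hK₀ : Spr K₀ := spr_KInvStep (d := 3) (Lc := n) 0
  obtain ⟨δK, CK, hδK, hCK, hKd⟩ := OneStepResolventKernel.decays_KInv (N := n) (d := 3)
  obtain ⟨Cs, -, hS⟩ := locStencil_JsB12CombSh0_S_zero_of_decays hodd N (symTablesAn1S2 3 n cΛ) cΛ (-((n : ℝ) ^ 12 / 4)) hKd hCK hδK
  -- g53's block envelope of the straight column
  have hcol : ∀ (μ' : Fin (3 + 1)) (y : Site (3 + 1)) (κ : Fin (3 + 1)) (u : Site (3 + 1)), |colH K₀ n μ' y κ u|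
      ≤ ((n : ℝ) ^ (3 + 2))⁻¹ * (MG163 (3 + 1) * periodConst (kappa163 (3 + 1)) 3)
          * Real.exp (-(kappa163 (3 + 1) / ((3 : ℝ) + 1) * supNorm (quo n u - y))) :=
    fun μ' y κ u => abs_colH_KInvStep_zero_le (d := 3) (N := n) hn1 μ' y κ u
  have hM : 0 ≤ ((n : ℝ) ^ (3 + 2))⁻¹ * (MG163 (3 + 1) * periodConst (kappa163 (3 + 1)) 3) :=
    (mul_nonneg_iff_of_pos_right (Real.exp_pos _)).1 ((abs_nonneg _).trans (hcol 0 0 0 0))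
  have hc : 0 < kappa163 (3 + 1) / ((3 : ℝ) + 1) := div_pos (kappa163_pos (3 + 1)) (by positivity)
  -- the generator is localised and commutes with the slice projector
  have hΛ : ∀ μ' y, Loc (Λc μ' y) := fun μ' y => by
    have hn0 : (0 : ℝ) < n := by exact_mod_cast hn1
    have hχ := abs_bmGaugeAt_weight_le hn1 (ctrOff_mem_box hn1) K₀ μ' y hM hc.le (hcol μ' y)
    exact loc_diagK_weight_legSite (by positivity) (by positivity) hχ (ctr 4 n) ((n : ℝ) ^ 4 / 2)
  have hΛE : ∀ μ' y, comp (Λc μ' y) (axEc (ctr (3 + 1) n) n) = comp (axEc (ctr (3 + 1) n) n) (Λc μ' y) :=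
    fun μ' y => comp_generator_axEc_comm _ _ _
  -- localisation of the straight first-order family
  have hV : ∀ μ' y, Loc (vertexOfK K₀ n S0 μ' y) := fun μ' y => loc_vertexOfK_of_spr hK₀ hS (half_pos hδK) μ' y
  -- FIRST ORDER: `V^{bm} = V^s + [Λc, bhK + Dsh]` (ColumnGaugeCombPartner §3), as an equality of families
  have eV : vertexOfK (coDressKBmAt (ctr 4 n) n K₀) n S0
      = fun μ' y => vertexOfK K₀ n S0 μ' y + (comp (Λc μ' y) (bhK n + Dsh n) - comp (bhK n + Dsh n) (Λc μ' y)) :=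
    funext fun μ' => funext fun y => vertexOfK_G0bm_S_zero_eq_add_comm hodd N cΛ (-((n : ℝ) ^ 12 / 4)) μ' y
  rw [eV]
  exact literal_sub_displaced_eq_dressed_level0 (Lc := n) (d := 3) hV hΛ hΛE hW μ ν z


end Record

end Summit.QuantumFields.BalabanUV.Beta.D1BFx.ChartDefectRepair

end
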